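import Literature.NumberTheory.Transcendental.PadicCW77Functions
import Summits.ABC.StewartYu.DescentLiouvilleQ
import HarnessLib

/-!
# Cell abc-stewartyu, WP-A3 (ix)–(x): the bridge from p2's `p`-adic set-up to the sign-free descent
# algebra, and the half step of the `2`-descent

`Summits/ABC/StewartYu/PadicCW77HalfStep.lean` — cell `abc-stewartyu` (HOME
`run/shared/lean/pub/abc-stewartyu/`, seat p3; one `abbrev` + theorems; no named fact), on top of
p2's `PadicCW77Setup/Functions.lean` (the signed set-up `PadicCW77.Setup`, its functions `F`, `Φ`)
and p3's `Descent*Q.lean` (the sign-free ℚ-algebra `SetupQ`).  Two parts (formerly staged as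
PadicDescentBridge / PadicCW77HalfStep):

**Part 1 — the bridge.** `PadicCW77.Setup.toQ : SetupQ` (same `d, α, θ, b, b_θ`) with `rfl`-lemmas
(`toQ_qE`, `toQ_qTerm`, `toQ_coreSum`, `flat_qΔ/γ/qA/box_eq_frame`, `flat_expn_eq`); the `Δ`-factor
at the half points (`DwQ_half_eq`, `Dw_half`), `termΦ_half`, **`Φ_half`**: for `J < J₀`,
`Φ_{J,τ}(s/2) = 2^{τ₀} · evL (psqrt ∘ all) (classVec_{J,τ,s})` in `ℚ_p`, and `norm_Φ_half`.

**Part 2 — the half step.** `liouvilleBound_anti`; **`classVec_eq_zero_of_norm_Φ_half_lt`** (if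
`‖φ_{J,τ}(s/2)‖_p` is below the sharp `p`-adic Liouville bound of the class-sum vector, all class
sums vanish: `Multiquad.norm_evL_ge_sharp` + `evL_ne_zero` on the principal roots `psqrt(allᵢ)`,
under the `2`-Kummer condition on the SIGNED generators); **`inv_succ_of_norm_Φ_half_lt`** (the
invariant `SetupQ.Inv` passes from `J` to `J+1` by `SetupQ.descent_algebra`).

The junctions to p2's `Inv`/`HalfStep` (which live in `PadicCW77Main`) follow in
`PadicCW77Junctions.lean`.  Everything is [folklore].
-/

noncomputable section

/-! ## Part 1 — the bridge `toQ` and `Φ` at the half points -/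

open NormedSpace Finset Polynomial
open Literature.NumberTheory.Transcendental
open Literature.NumberTheory.Transcendental.CW77.Setup (Idx Tau tauNorm scale Qw_zero_right)
open Literature.NumberTheory.Transcendental.Baker1975.Ch3 (Qw)

namespace Literature.NumberTheory.Transcendental.PadicCW77.Setup

open Summit.ABC.StewartYu

variable (S : PadicCW77.Setup) {h Lb : ℕ}

/-! ### Forgetting the `p`-adic data -/

/-- The underlying sign-free algebraic datum of a `p`-adic set-up (an `abbrev`, so that `S.toQ.d`
unfolds to `S.d` reducibly). [folklore] -/
abbrev toQ : SetupQ := ⟨S.d, S.α, S.θ, S.α_ne, S.θ_ne, S.b, S.bθ, S.bθ_ne⟩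

/-- `toQ` keeps the generators. [folklore] -/
@[simp] theorem toQ_all : S.toQ.all = S.all := rfl

/-- `toQ` keeps `qE`. [folklore] -/
theorem toQ_qE (u : Idx S.d h Lb) (s : ℕ) : S.toQ.qE u s = S.qE u s := rfl

/-- `flat.qΔ = frame.qΔ` (generator-free). [folklore] -/
theorem flat_qΔ_eq_frame (J₀ J : ℕ) (u : Idx S.d h Lb) (τ₀ s : ℕ) :
    S.toQ.flat.qΔ J₀ J u τ₀ s = S.frame.qΔ J₀ J u τ₀ s := rfl

/-- `flat.γ = frame.γ` (generator-free). [folklore] -/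
theorem flat_γ_eq_frame (u : Idx S.d h Lb) (j : Fin S.d) : S.toQ.flat.γ u j = S.frame.γ u j := rfl

/-- `flat.qA = frame.qA` (generator-free). [folklore] -/
theorem flat_qA_eq_frame (u : Idx S.d h Lb) (τ' : Fin S.d → ℕ) :
    S.toQ.flat.qA u τ' = S.frame.qA u τ' := rfl

/-- `flat.box = frame.box` (generator-free). [folklore] -/
theorem flat_box_eq_frame (L : Fin S.d → ℕ) (Lθ J : ℕ) :
    S.toQ.flat.box (h := h) (Lb := Lb) L Lθ J = S.frame.box (h := h) (Lb := Lb) L Lθ J := rfl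

/-- `flat.expn = expn`. [folklore] -/
theorem flat_expn_eq (u : Idx S.d h Lb) (s : ℕ) : S.toQ.flat.expn u s = S.expn u s := rfl

/-- `toQ` keeps `qTerm`. [folklore] -/
theorem toQ_qTerm (J₀ J : ℕ) (u : Idx S.d h Lb) (τ : Tau S.d) (s : ℕ) :
    S.toQ.qTerm J₀ J u τ s = S.qTerm J₀ J u τ s := rfl

/-- `toQ` keeps `coreSum`. [folklore] -/
theorem toQ_coreSum (J₀ J : ℕ) (box : Finset (Idx S.d h Lb)) (p : Idx S.d h Lb → ℤ) (τ : Tau S.d)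
    (s : ℕ) : S.toQ.coreSum J₀ J box p τ s = S.coreSum J₀ J box p τ s := rfl

/-! ### The `Δ`-factor at the half points -/

/-- **`DwQ (2^{J₀−J}) r l h τ₀ (s/2) = 2^{τ₀} · qΔ_{J+1}(s)`** for `J < J₀` (the complex identity
`CW77.Setup.Qw_wOf_half` of the frame, transported to `ℚ`). [folklore] -/
theorem DwQ_half_eq {J₀ J : ℕ} (hJ : J < J₀) (u : Idx S.d h Lb) (τ₀ s : ℕ) :
    DwQ (2 ^ (J₀ - J)) (u.1.1 : ℕ) (u.1.2 : ℕ) h τ₀ ((s : ℚ) / 2) =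
      2 ^ τ₀ * S.frame.qΔ J₀ (J + 1) u τ₀ s := by
  apply Rat.cast_injective (α := ℂ)
  have h1 := S.frame.Qw_wOf_half hJ u τ₀ s
  rw [Qw_zero_right] at h1
  push_cast
  rw [← h1]
  unfold DwQ CW77.Setup.wOf
  rw [← Waldschmidt1980.map_wScaled, iterate_derivative_map, Polynomial.eval_map,
    show ((s : ℂ) / 2) = algebraMap ℚ ℂ ((s : ℚ) / 2) by simp, Polynomial.eval₂_at_apply]
  simp

/-- **`Dw τ₀ (s/2) = 2^{τ₀} · qΔ_{J+1}(s)`** in `ℚ_p` (`J < J₀`). [folklore] -/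
theorem Dw_half {J₀ J : ℕ} (hJ : J < J₀) (u : Idx S.d h Lb) (τ₀ s : ℕ) :
    S.Dw J₀ J u τ₀ ((2 : ℚ_[S.p])⁻¹ * (s : ℚ_[S.p])) =
      (2 : ℚ_[S.p]) ^ τ₀ * (S.frame.qΔ J₀ (J + 1) u τ₀ s : ℚ_[S.p]) := by
  have hx : ((2 : ℚ_[S.p])⁻¹ * (s : ℚ_[S.p])) = (((s : ℚ) / 2 : ℚ) : ℚ_[S.p]) := by
    push_cast; ring
  rw [hx, S.Dw_ratCast, S.DwQ_half_eq hJ]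
  push_cast; ring

/-! ### The values of `φ_{J,τ}` at the half points -/

/-- One term: `termΦ(s/2) = 2^{τ₀} · (qΔ_{J+1} qA)(u) · ∏ᵢ psqrt(allᵢ)^{expnᵢ(u,s)}` (`J < J₀`).
[folklore] -/
theorem termΦ_half {J₀ J : ℕ} (hJ : J < J₀) (u : Idx S.d h Lb) (τ : Tau S.d) (s : ℕ) :
    S.termΦ J₀ J u τ ((2 : ℚ_[S.p])⁻¹ * (s : ℚ_[S.p])) =
      (2 : ℚ_[S.p]) ^ τ.1 * ((S.frame.qΔ J₀ (J + 1) u τ.1 s * S.frame.qA u τ.2 : ℚ) : ℚ_[S.p]) *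
        ∏ i : Fin (S.d + 1), PadicExp.psqrt (S.all i : ℚ_[S.p]) ^ S.expn u s i := by
  unfold termΦ
  rw [S.Dw_half hJ, S.A_eq, S.exp_ψ_half_natCast]
  push_cast; ring

/-- **`φ_{J,τ}(s/2) = 2^{τ₀} · evL (psqrt ∘ all) (classVec_{J,τ,s})`** (`J < J₀`): the value at a
half point is `2^{τ₀}` times the evaluation of the signed class-sum vector on the monomials in the
principal `p`-adic square roots of the generators. [folklore] -/
theorem Φ_half {J₀ J : ℕ} (hJ : J < J₀) (box : Finset (Idx S.d h Lb)) (p : Idx S.d h Lb → ℤ)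
    (τ : Tau S.d) (s : ℕ) :
    S.Φ J₀ J box p τ ((2 : ℚ_[S.p])⁻¹ * (s : ℚ_[S.p])) =
      (2 : ℚ_[S.p]) ^ τ.1 *
        Multiquad.evL (fun i => PadicExp.psqrt (S.all i : ℚ_[S.p])) (S.toQ.classVec J₀ J box p τ s) := by
  have hr : ∀ i : Fin (S.d + 1), PadicExp.psqrt (S.all i : ℚ_[S.p]) * PadicExp.psqrt (S.all i : ℚ_[S.p]) =
      ((S.toQ.all i : ℚ) : ℚ_[S.p]) := fun i => by
    rw [toQ_all]; exact PadicExp.psqrt_mul_self S.hp3 (S.norm_one_sub_all_le i)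
  rw [← S.toQ.sum_half_eq_evL_classVec _ hr J₀ J box p τ s]
  unfold Φ
  rw [mul_sum]
  refine sum_congr rfl fun u _ => ?_
  rw [S.termΦ_half hJ]
  simp only [flat_qΔ_eq_frame, flat_qA_eq_frame, flat_expn_eq]
  ring

/-- `‖2^{τ₀}‖_p = 1` (`p` odd). [folklore] -/
theorem norm_two_pow (τ₀ : ℕ) : ‖(2 : ℚ_[S.p]) ^ τ₀‖ = 1 := by
  rw [norm_pow, PadicExp.norm_two_eq_one S.hp3, one_pow]

/-- **`‖φ_{J,τ}(s/2)‖_p = ‖evL (psqrt ∘ all) (classVec_{J,τ,s})‖_p`** (`J < J₀`). [folklore] -/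
theorem norm_Φ_half {J₀ J : ℕ} (hJ : J < J₀) (box : Finset (Idx S.d h Lb)) (p : Idx S.d h Lb → ℤ)
    (τ : Tau S.d) (s : ℕ) :
    ‖S.Φ J₀ J box p τ ((2 : ℚ_[S.p])⁻¹ * (s : ℚ_[S.p]))‖ =
      ‖Multiquad.evL (fun i => PadicExp.psqrt (S.all i : ℚ_[S.p])) (S.toQ.classVec J₀ J box p τ s)‖ := by
  rw [S.Φ_half hJ, norm_mul, S.norm_two_pow, one_mul]

end Literature.NumberTheory.Transcendental.PadicCW77.Setup

/-! ## Part 2 — the half step -/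

open NormedSpace Finset
open Literature.NumberTheory.Transcendental
open Literature.NumberTheory.Transcendental.CW77 (heightProd)
open Literature.NumberTheory.Transcendental.CW77.Setup (Idx Tau tauNorm)

namespace Literature.NumberTheory.Transcendental.PadicCW77.Setup

open Summit.ABC.StewartYu

variable (S : PadicCW77.Setup) {h Lb : ℕ}

/-- **Monotonicity of the sharp Liouville bound**: `D'/(4D'²M'P³)^E ≤ D/(4D²MP³)^E` for
`1 ≤ D ≤ D'`, `1 ≤ M ≤ M'`, `P > 0`, `E ≥ 1`. [folklore] -/
theorem liouvilleBound_anti {D D' M M' P : ℝ} {E : ℕ} (hE : 1 ≤ E) (hD : 1 ≤ D) (hDD' : D ≤ D')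
    (hM : 1 ≤ M) (hMM' : M ≤ M') (hP : 0 < P) :
    D' / (4 * D' ^ 2 * M' * P ^ 3) ^ E ≤ D / (4 * D ^ 2 * M * P ^ 3) ^ E := by
  have hD0 : 0 < D := by linarith
  have hD'0 : 0 < D' := by linarith
  have hM0 : 0 < M := by linarith
  have hM'0 : 0 < M' := by linarith
  rw [div_le_div_iff₀ (by positivity) (by positivity)]
  obtain ⟨n, hn⟩ : ∃ n, 2 * E = n + 1 := ⟨2 * E - 1, by omega⟩
  have hD2 : (D ^ 2) ^ E = D ^ n * D := by rw [← pow_mul, hn, pow_succ]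
  have hD'2 : (D' ^ 2) ^ E = D' ^ n * D' := by rw [← pow_mul, hn, pow_succ]
  have e1 : (4 * D ^ 2 * M * P ^ 3) ^ E = (4 * P ^ 3) ^ E * (D ^ n * D) * M ^ E := by
    rw [← hD2, mul_pow, mul_pow, mul_pow]; ring
  have e2 : (4 * D' ^ 2 * M' * P ^ 3) ^ E = (4 * P ^ 3) ^ E * (D' ^ n * D') * M' ^ E := by
    rw [← hD'2, mul_pow, mul_pow, mul_pow]; ring
  rw [e1, e2]
  have h1 : D ^ n ≤ D' ^ n := pow_le_pow_left₀ hD0.le hDD' n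
  have h2 : M ^ E ≤ M' ^ E := pow_le_pow_left₀ hM0.le hMM' E
  have h4P : 0 ≤ (4 * P ^ 3) ^ E := by positivity
  calc D' * ((4 * P ^ 3) ^ E * (D ^ n * D) * M ^ E)
      = (4 * P ^ 3) ^ E * (D * D') * (D ^ n * M ^ E) := by ring
    _ ≤ (4 * P ^ 3) ^ E * (D * D') * (D' ^ n * M' ^ E) := by
        refine mul_le_mul_of_nonneg_left ?_ (by positivity)
        exact mul_le_mul h1 h2 (by positivity) (by positivity)
    _ = D * ((4 * P ^ 3) ^ E * (D' ^ n * D') * M' ^ E) := by ring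

/-- **Vanishing of the class sums from `p`-adic smallness at a half point** (`J < J₀`): under the
`2`-Kummer condition on the signed generators, if `∑_{T'} |classVec_{J,τ,s}(T')| ≤ M` (`M ≥ 1`) and
`‖φ_{J,τ}(s/2)‖_p < Dhalf♭/(4 Dhalf♭² M (∏ᵢ H(allᵢ))³)^{2^{d+1}}`, then `classVec_{J,τ,s} = 0`.
[folklore] -/
theorem classVec_eq_zero_of_norm_Φ_half_lt {J₀ J : ℕ} (hJ : J < J₀)
    (hind : ∀ T' : Finset (Fin (S.d + 1)), T'.Nonempty → ¬ IsSquare (∏ i ∈ T', S.all i))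
    (L : Fin S.d → ℕ) (Lθ : ℕ) (pv : Idx S.d h Lb → ℤ) (τ : Tau S.d) (s : ℕ) {M : ℝ} (hM : 1 ≤ M)
    (hcM : ∑ T', |(S.toQ.classVec J₀ J (S.toQ.flat.box (h := h) (Lb := Lb) L Lθ J) pv τ s T' : ℝ)| ≤ M)
    (hlt : ‖S.Φ J₀ J (S.toQ.flat.box (h := h) (Lb := Lb) L Lθ J) pv τ ((2 : ℚ_[S.p])⁻¹ * (s : ℚ_[S.p]))‖ <
      (S.toQ.flat.Dhalf (h := h) J₀ J L Lθ s τ : ℝ) /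
        (4 * (S.toQ.flat.Dhalf (h := h) J₀ J L Lθ s τ : ℝ) ^ 2 * M * heightProd S.all ^ 3) ^ (2 ^ (S.d + 1))) :
    S.toQ.classVec J₀ J (S.toQ.flat.box (h := h) (Lb := Lb) L Lθ J) pv τ s = 0 := by
  rw [S.norm_Φ_half hJ] at hlt
  have hr : ∀ i : Fin (S.d + 1), PadicExp.psqrt (S.all i : ℚ_[S.p]) * PadicExp.psqrt (S.all i : ℚ_[S.p]) =
      ((S.toQ.all i : ℚ) : ℚ_[S.p]) := fun i => by
    rw [toQ_all]; exact PadicExp.psqrt_mul_self S.hp3 (S.norm_one_sub_all_le i)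
  have hr1 : ∀ i : Fin (S.d + 1), ‖PadicExp.psqrt (S.all i : ℚ_[S.p])‖ ≤ 1 := fun i =>
    (PadicExp.norm_psqrt S.hp3 (S.norm_one_sub_all_le i)).le
  have hind' : ∀ T' : Finset (Fin (S.toQ.d + 1)), T'.Nonempty → ¬ IsSquare (∏ i ∈ T', S.toQ.all i) := hind
  exact S.toQ.classVec_eq_zero_of_padicNorm_lt hind' _ hr hr1 J₀ J L Lθ pv τ s hM hcM hlt

/-- **The half step of the `p`-adic descent** (twin of `CW77.Setup.w80_halfstep`'s logic): from the
invariant at level `J < J₀`, uniform bounds `Dhalf♭(s,τ) ≤ Dmax` and `∑_{T'}|classVec_{J,τ,s}(T')| ≤ Mmax`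
for all odd `s < 2^{J+1} S₀`, `|τ| < T/2^{J+1}`, and the `p`-adic smallness
`‖φ_{J,τ}(s/2)‖_p < Dmax/(4 Dmax² Mmax (∏ᵢ H(allᵢ))³)^{2^{d+1}}` at those points (the output of the
ultrametric Schwarz lemma and the parameter inequality), the invariant holds at level `J + 1`.
[folklore] -/
theorem inv_succ_of_norm_Φ_half_lt {J₀ J : ℕ} (hJ : J < J₀)
    (hind : ∀ T' : Finset (Fin (S.d + 1)), T'.Nonempty → ¬ IsSquare (∏ i ∈ T', S.all i))
    {L : Fin S.d → ℕ} {Lθ S₀ T : ℕ} {P : ℤ} {pv : Idx S.d h Lb → ℤ}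
    (inv : S.toQ.Inv J₀ L Lθ S₀ T P J pv) {Dmax Mmax : ℝ} (hMmax : 1 ≤ Mmax)
    (hD : ∀ s, s < 2 ^ (J + 1) * S₀ → Odd s → ∀ τ : Tau S.d, tauNorm τ < T / 2 ^ (J + 1) →
      ((S.toQ.flat.Dhalf (h := h) J₀ J L Lθ s τ : ℕ) : ℝ) ≤ Dmax)
    (hM : ∀ s, s < 2 ^ (J + 1) * S₀ → Odd s → ∀ τ : Tau S.d, tauNorm τ < T / 2 ^ (J + 1) →
      ∑ T', |(S.toQ.classVec J₀ J (S.toQ.flat.box (h := h) (Lb := Lb) L Lθ J) pv τ s T' : ℝ)| ≤ Mmax)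
    (hsmall : ∀ s, s < 2 ^ (J + 1) * S₀ → Odd s → ∀ τ : Tau S.d, tauNorm τ < T / 2 ^ (J + 1) →
      ‖S.Φ J₀ J (S.toQ.flat.box (h := h) (Lb := Lb) L Lθ J) pv τ ((2 : ℚ_[S.p])⁻¹ * (s : ℚ_[S.p]))‖ <
        Dmax / (4 * Dmax ^ 2 * Mmax * heightProd S.all ^ 3) ^ (2 ^ (S.d + 1))) :
    ∃ p' : Idx S.d h Lb → ℤ, S.toQ.Inv J₀ L Lθ S₀ T P (J + 1) p' := by
  refine S.toQ.descent_algebra inv fun s hs hodd τ hτ => ?_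
  have hD1 : (1 : ℝ) ≤ (S.toQ.flat.Dhalf (h := h) J₀ J L Lθ s τ : ℕ) := by
    exact_mod_cast S.toQ.flat.Dhalf_pos J₀ J L Lθ s τ
  have hP : 0 < heightProd S.all := lt_of_lt_of_le one_pos (CW77.one_le_heightProd _)
  have hE : 1 ≤ 2 ^ (S.d + 1) := Nat.one_le_two_pow
  have hmono := liouvilleBound_anti hE hD1 (hD s hs hodd τ hτ) hMmax le_rfl hP
  -- use `M := Mmax` for the class sums at `(s, τ)`
  refine S.classVec_eq_zero_of_norm_Φ_half_lt hJ hind L Lθ pv τ s hMmax (hM s hs hodd τ hτ) ?_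
  exact lt_of_lt_of_le (hsmall s hs hodd τ hτ) hmono

end Literature.NumberTheory.Transcendental.PadicCW77.Setup

end
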